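import Summits.Ventures.CertifiedManyBodySolver.Downfold.EmeryClusterFloorSeamFilling
import Summits.Ventures.CertifiedManyBodySolver.Downfold.EmeryCuprateSigns
import Summits.Ventures.CertifiedManyBodySolver.Downfold.EmeryBoxesKSlicesB
import Literature.MathematicalPhysics.QuantumLattice.EmeryThreeBandCuO4ClusterDictionary
import Summits.Ventures.CertifiedManyBodySolver.Certificates.HubbardSquare_kgp1x5_NCCOx_c0_ll_mum80o10_G
import Summits.Ventures.CertifiedManyBodySolver.Certificates.HubbardSquare_kgp1x5_NCCOx_c1_hl_mum90o10_G
import Summits.Ventures.CertifiedManyBodySolver.Certificates.HubbardSquare_kgp1x5_NCCOx_c2_lh_mum86o10_G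
import Summits.Ventures.CertifiedManyBodySolver.Certificates.HubbardSquare_kgp1x5_NCCOx_c3_hh_mum95o10_G
import HarnessLib

/-!
# CERTIFIED THREE-BAND (EMERY) WORD: Nd1.85Ce0.15CuO4 (M20) [#55 x0.10 / #56 Nd2CuO4 x0 share the one-body rows] — U-SLICE «(K) — `emeryBoxNCCOK26`:
# `e(emeryLine cuprateSigns ·, ρ = 103/80) ≥ 536597/320000 = 1.6768656 eV per lattice site` (= `6.7074625 eV per CuO₂`)

Venture CertifiedManyBodySolver, cell `pub/hubbard-downfold` (S1 = ROUTER) × crew hubbard-fast S2 (iv) «three-band Emery boxes»; seat hubbard-downfold-mod-4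
(S1/S2 Emery seam; closing file by the recipe `router/INFLATION-RULES-3to1-B.md` §B.38 (j), generator `hubbard-downfold-mod-4/floor-orders/make_word_file.py`).
Namespace `Summit.Ventures.CertifiedManyBodySolver.Downfold`.

THE CHAIN (kernel-checked, std axioms, 0 sorry): LAW + DICTIONARY + GLUE (hubbard-box-p1: `EmeryThreeBandClusterFloor`, `EmeryThreeBandStatesNonempty`,
`EmeryThreeBandCuO4ClusterDictionary` — `posSemidef_cuO4_uniform_add_zero_sub_of_gpSectorFloors`) · WINDOW + SEAM + SIGN + DOORS (this seat: `EmeryThreeBandCuO4WindowFloor`,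
`EmeryClusterFloorSeam(Free/Filling)`, `EmeryCuprateSigns`) · TABLES (this seat, `router/EMERY-FLOOR-ORDERS.tsv` row 53) · DEVICE + CERTIFICATES (hubbard-box-p2:
`Certificates/HubbardSquare_kgp1x5_{NCCOx_c0_ll_mum80o10, NCCOx_c1_hl_mum90o10, NCCOx_c2_lh_mum86o10, NCCOx_c3_hh_mum95o10}_{S0,S1,F,G}`, Q = 80000, mass M = 2, tilts μ = -8, -9, -43/5, -19/2,
certified levels q₀ = -2654597/40000, -6279593/80000, -1467193/20000, -3377403/40000).

THE OBJECT: `emeryBoxNCCOK26` (`EmeryBoxesKSlicesB`; router/EMERY-FLOOR-ORDERS.tsv row 53): delivered six-box corners (t_pd | t_pp) ∈ {9/10, 129/100} × {13/25, 18/25},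
(ε_d, ε_p, U_d, U_p) = (13/25, 0, 5287/1000, 2249/500) eV; n_holes ∈ [17/20, 17/20] ⇒ cell filling ρ ∈ [103/80, 103/80]. Grade of the object: EXTRAPOLATED / by-reference U-SLICE (S2 row of record per EMERY-LINE).

THIS FILE: §0 the corner sheet `nCCOK26Corner` (= `lowerCorner` of the delivered six-box); §1 per corner the tilted coupling vector, the three TABLE IDENTITIES (box-p2's
integer tables / Q = box-p1's `plusTau / plusUps / plusNu` at θᵢ, M = 2) and the `PosSemidef` certificate; §2 tilts / levels / `hq` / floor checks (corner lines
q₀ᵢ/8 − μᵢρ at ρ = 103/80: 2.00438 / 1.77564 / 1.90254 / 1.67687; minimum = corner 3); §3 **THE WORD** `emeryBoxNCCOK26_cuprate_energyFloor` + 4-dp reading;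
§4 the filling line `nCCOK26FloorLine ρ = 19/2·ρ − 3377403/320000` (corner 3's line, the envelope for ρ ∈ [0, 37/25]) and the fixed-ρ word on that range.

HONEST FRAMING: a CERTIFIED inequality on a EXTRAPOLATED / by-reference U-SLICE (S2 row of record per EMERY-LINE) object (box ends are [float] literature / DFT with locators in `router/EMERY-FLOOR-ORDERS.tsv row 53`); a uniform-weight
single-CuO₄ Anderson floor — crude by construction; an ENERGY word — nothing about superconductivity, no phase sentence, no number of record at a router anchor moves;
INFL-3to1 stays screening-grade.
-/

noncomputable section

namespace Summit.Ventures.CertifiedManyBodySolver.Downfold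

open NonemptyInterval Matrix Finset Literature.Probability.LatticeModels
open Literature.MathematicalPhysics.QuantumLattice Literature.Computation.Certificates
open Summit.Ventures.CertifiedManyBodySolver.Certificates OccupationCode ClusterLowerBound
open scoped BigOperators ComplexOrder

/-! ## §0 The corner sheet -/

/-- **The floor order sheet of `emeryBoxNCCOK26`** (order `(t_pd, t_pp, ε_d, ε_p, U_d, U_p)`, eV, `εp = 0`): the four lower-face corners of its delivered six-box
(router/EMERY-FLOOR-ORDERS.tsv row 53). [folklore] -/
def nCCOK26Corner : Fin 4 → Fin 6 → ℝ :=
  ![![9/10, 13/25, 13/25, 0, 5287/1000, 2249/500], ![129/100, 13/25, 13/25, 0, 5287/1000, 2249/500], ![9/10, 18/25, 13/25, 0, 5287/1000, 2249/500], ![129/100, 18/25, 13/25, 0, 5287/1000, 2249/500]]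

/-- The order sheet IS the lower-corner list of the delivered six-box. [folklore] -/
theorem nCCOK26_lowerCorner :
    lowerCorner (emeryLo 0 nccoK26Emery_tpd nccoK26Emery_tpp nccoK26Emery_Delta nccoK26Emery_Udd nccoK26Emery_Upp) (emeryHi 0 nccoK26Emery_tpd nccoK26Emery_tpp nccoK26Emery_Delta nccoK26Emery_Udd nccoK26Emery_Upp) = nCCOK26Corner := by
  ext i k
  fin_cases i <;> fin_cases k <;> simp [lowerCorner, nCCOK26Corner, emeryLo, emeryHi, nccoK26Emery_tpd, nccoK26Emery_tpp, nccoK26Emery_Delta, nccoK26Emery_Udd, nccoK26Emery_Upp]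

/-! ## §1 The four corners: table identities and certificates -/

/-- The tilted coupling vector at corner 0 (`nCCOK26Corner 0`, tilt `μ = -8`), explicitly. [folklore] -/
theorem nCCOK26Floor_theta0 :
    emeryLine cuprateSigns (nCCOK26Corner 0) + (-8 : ℝ) • levelDir =
      ![9/10, 9/10, 9/10, 9/10, -(13/25), -(13/25), -(13/25), -(13/25), 13/25 - 8, -(8), -(8), 5287/1000, 2249/500, 2249/500] := by
  rw [emeryLine_cuprateSigns]
  ext a
  fin_cases a <;> simp [nCCOK26Corner, levelDir]
  all_goals norm_num

/-- **Table identity τ, corner 0**: box-p2's hopping table `symW W0 / 80000` IS `plusTau θ_0 2`. [cite: ValentiStolzeHirschfeld1991, §II] -/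
theorem nCCOK26Floor_tau0 :
    (fun x y : Fin 1 ×ₗ Fin 5 => ((symW kgp1x5_NCCOx_c0_ll_mum80o10_W0 (siteRank x) (siteRank y) : ℤ) : ℝ) / (80000 : ℕ)) =
      plusTau (emeryLine cuprateSigns (nCCOK26Corner 0) + (-8 : ℝ) • levelDir) 2 := by
  rw [nCCOK26Floor_theta0]
  funext i j
  obtain ⟨⟨a, b⟩, rfl⟩ := toLex.surjective i
  obtain ⟨⟨c, d⟩, rfl⟩ := toLex.surjective j
  fin_cases a; fin_cases c
  fin_cases b <;> fin_cases d <;> simp [plusTau, symW, siteRank, kgp1x5_NCCOx_c0_ll_mum80o10_W0]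
  all_goals norm_num

/-- **Table identity υ, corner 0**: box-p2's repulsion table `V / 80000` IS `plusUps θ_0 2`. [cite: ValentiStolzeHirschfeld1991, §II] -/
theorem nCCOK26Floor_ups0 :
    (fun x : Fin 1 ×ₗ Fin 5 => ((kgp1x5_NCCOx_c0_ll_mum80o10_V (siteRank x) : ℤ) : ℝ) / (80000 : ℕ)) =
      plusUps (emeryLine cuprateSigns (nCCOK26Corner 0) + (-8 : ℝ) • levelDir) 2 := by
  rw [nCCOK26Floor_theta0]
  funext i
  obtain ⟨⟨a, b⟩, rfl⟩ := toLex.surjective i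
  fin_cases a
  fin_cases b <;> simp [plusUps, siteRank, kgp1x5_NCCOx_c0_ll_mum80o10_V]
  all_goals norm_num

/-- **Table identity ν, corner 0**: box-p2's potential table `M / 80000` (tilt folded in) IS `plusNu θ_0 2`. [cite: ValentiStolzeHirschfeld1991, §II] -/
theorem nCCOK26Floor_nu0 :
    (fun x : Fin 1 ×ₗ Fin 5 => ((kgp1x5_NCCOx_c0_ll_mum80o10_M (siteRank x) : ℤ) : ℝ) / (80000 : ℕ)) =
      plusNu (emeryLine cuprateSigns (nCCOK26Corner 0) + (-8 : ℝ) • levelDir) 2 := by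
  rw [nCCOK26Floor_theta0]
  funext i
  obtain ⟨⟨a, b⟩, rfl⟩ := toLex.surjective i
  fin_cases a
  fin_cases b <;> simp [plusNu, siteRank, kgp1x5_NCCOx_c0_ll_mum80o10_M]
  all_goals norm_num

/-- **The cluster certificate at corner 0**: `H^(w_2)_(W₅)[emeryInteraction θ_0] + 0 − q₀·1 ⪰ 0` with `q₀ = -2654597/40000` — box-p2's kernel sector floors
`kgp1x5_NCCOx_c0_ll_mum80o10_floor_min` through box-p1's dictionary + glue. [cite: Anderson1951, eq. (2)] -/
theorem nCCOK26Floor_hq0 :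
    ((⟨fun X => (uniformPeriodicWeight liebPeriods emeryCuO4Window 2 X : ℂ) •
        (emeryInteraction (emeryLine cuprateSigns (nCCOK26Corner 0) + (-8 : ℝ) • levelDir)).Φ X⟩ : FermionInteraction 2).localHamiltonian emeryCuO4Window +
        (0 : FermionOp emeryCuO4Window) - ((-2654597/40000 : ℝ) : ℂ) • (1 : FermionOp emeryCuO4Window)).PosSemidef := by
  refine posSemidef_cuO4_uniform_add_zero_sub_of_gpSectorFloors _ 2 fun k hk => ?_
  have h := kgp1x5_NCCOx_c0_ll_mum80o10_floor_min k hk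
  rw [nCCOK26Floor_tau0, nCCOK26Floor_ups0, nCCOK26Floor_nu0] at h
  exact_mod_cast h

/-- The tilted coupling vector at corner 1 (`nCCOK26Corner 1`, tilt `μ = -9`), explicitly. [folklore] -/
theorem nCCOK26Floor_theta1 :
    emeryLine cuprateSigns (nCCOK26Corner 1) + (-9 : ℝ) • levelDir =
      ![129/100, 129/100, 129/100, 129/100, -(13/25), -(13/25), -(13/25), -(13/25), 13/25 - 9, -(9), -(9), 5287/1000, 2249/500, 2249/500] := by
  rw [emeryLine_cuprateSigns]
  ext a
  fin_cases a <;> simp [nCCOK26Corner, levelDir]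
  all_goals norm_num

/-- **Table identity τ, corner 1**: box-p2's hopping table `symW W0 / 80000` IS `plusTau θ_1 2`. [cite: ValentiStolzeHirschfeld1991, §II] -/
theorem nCCOK26Floor_tau1 :
    (fun x y : Fin 1 ×ₗ Fin 5 => ((symW kgp1x5_NCCOx_c1_hl_mum90o10_W0 (siteRank x) (siteRank y) : ℤ) : ℝ) / (80000 : ℕ)) =
      plusTau (emeryLine cuprateSigns (nCCOK26Corner 1) + (-9 : ℝ) • levelDir) 2 := by
  rw [nCCOK26Floor_theta1]
  funext i j
  obtain ⟨⟨a, b⟩, rfl⟩ := toLex.surjective i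
  obtain ⟨⟨c, d⟩, rfl⟩ := toLex.surjective j
  fin_cases a; fin_cases c
  fin_cases b <;> fin_cases d <;> simp [plusTau, symW, siteRank, kgp1x5_NCCOx_c1_hl_mum90o10_W0]
  all_goals norm_num

/-- **Table identity υ, corner 1**: box-p2's repulsion table `V / 80000` IS `plusUps θ_1 2`. [cite: ValentiStolzeHirschfeld1991, §II] -/
theorem nCCOK26Floor_ups1 :
    (fun x : Fin 1 ×ₗ Fin 5 => ((kgp1x5_NCCOx_c1_hl_mum90o10_V (siteRank x) : ℤ) : ℝ) / (80000 : ℕ)) =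
      plusUps (emeryLine cuprateSigns (nCCOK26Corner 1) + (-9 : ℝ) • levelDir) 2 := by
  rw [nCCOK26Floor_theta1]
  funext i
  obtain ⟨⟨a, b⟩, rfl⟩ := toLex.surjective i
  fin_cases a
  fin_cases b <;> simp [plusUps, siteRank, kgp1x5_NCCOx_c1_hl_mum90o10_V]
  all_goals norm_num

/-- **Table identity ν, corner 1**: box-p2's potential table `M / 80000` (tilt folded in) IS `plusNu θ_1 2`. [cite: ValentiStolzeHirschfeld1991, §II] -/
theorem nCCOK26Floor_nu1 :
    (fun x : Fin 1 ×ₗ Fin 5 => ((kgp1x5_NCCOx_c1_hl_mum90o10_M (siteRank x) : ℤ) : ℝ) / (80000 : ℕ)) =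
      plusNu (emeryLine cuprateSigns (nCCOK26Corner 1) + (-9 : ℝ) • levelDir) 2 := by
  rw [nCCOK26Floor_theta1]
  funext i
  obtain ⟨⟨a, b⟩, rfl⟩ := toLex.surjective i
  fin_cases a
  fin_cases b <;> simp [plusNu, siteRank, kgp1x5_NCCOx_c1_hl_mum90o10_M]
  all_goals norm_num

/-- **The cluster certificate at corner 1**: `H^(w_2)_(W₅)[emeryInteraction θ_1] + 0 − q₀·1 ⪰ 0` with `q₀ = -6279593/80000` — box-p2's kernel sector floors
`kgp1x5_NCCOx_c1_hl_mum90o10_floor_min` through box-p1's dictionary + glue. [cite: Anderson1951, eq. (2)] -/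
theorem nCCOK26Floor_hq1 :
    ((⟨fun X => (uniformPeriodicWeight liebPeriods emeryCuO4Window 2 X : ℂ) •
        (emeryInteraction (emeryLine cuprateSigns (nCCOK26Corner 1) + (-9 : ℝ) • levelDir)).Φ X⟩ : FermionInteraction 2).localHamiltonian emeryCuO4Window +
        (0 : FermionOp emeryCuO4Window) - ((-6279593/80000 : ℝ) : ℂ) • (1 : FermionOp emeryCuO4Window)).PosSemidef := by
  refine posSemidef_cuO4_uniform_add_zero_sub_of_gpSectorFloors _ 2 fun k hk => ?_
  have h := kgp1x5_NCCOx_c1_hl_mum90o10_floor_min k hk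
  rw [nCCOK26Floor_tau1, nCCOK26Floor_ups1, nCCOK26Floor_nu1] at h
  exact_mod_cast h

/-- The tilted coupling vector at corner 2 (`nCCOK26Corner 2`, tilt `μ = -43/5`), explicitly. [folklore] -/
theorem nCCOK26Floor_theta2 :
    emeryLine cuprateSigns (nCCOK26Corner 2) + (-43/5 : ℝ) • levelDir =
      ![9/10, 9/10, 9/10, 9/10, -(18/25), -(18/25), -(18/25), -(18/25), 13/25 - 43/5, -(43/5), -(43/5), 5287/1000, 2249/500, 2249/500] := by
  rw [emeryLine_cuprateSigns]
  ext a
  fin_cases a <;> simp [nCCOK26Corner, levelDir]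
  all_goals norm_num

/-- **Table identity τ, corner 2**: box-p2's hopping table `symW W0 / 80000` IS `plusTau θ_2 2`. [cite: ValentiStolzeHirschfeld1991, §II] -/
theorem nCCOK26Floor_tau2 :
    (fun x y : Fin 1 ×ₗ Fin 5 => ((symW kgp1x5_NCCOx_c2_lh_mum86o10_W0 (siteRank x) (siteRank y) : ℤ) : ℝ) / (80000 : ℕ)) =
      plusTau (emeryLine cuprateSigns (nCCOK26Corner 2) + (-43/5 : ℝ) • levelDir) 2 := by
  rw [nCCOK26Floor_theta2]
  funext i j
  obtain ⟨⟨a, b⟩, rfl⟩ := toLex.surjective i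
  obtain ⟨⟨c, d⟩, rfl⟩ := toLex.surjective j
  fin_cases a; fin_cases c
  fin_cases b <;> fin_cases d <;> simp [plusTau, symW, siteRank, kgp1x5_NCCOx_c2_lh_mum86o10_W0]
  all_goals norm_num

/-- **Table identity υ, corner 2**: box-p2's repulsion table `V / 80000` IS `plusUps θ_2 2`. [cite: ValentiStolzeHirschfeld1991, §II] -/
theorem nCCOK26Floor_ups2 :
    (fun x : Fin 1 ×ₗ Fin 5 => ((kgp1x5_NCCOx_c2_lh_mum86o10_V (siteRank x) : ℤ) : ℝ) / (80000 : ℕ)) =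
      plusUps (emeryLine cuprateSigns (nCCOK26Corner 2) + (-43/5 : ℝ) • levelDir) 2 := by
  rw [nCCOK26Floor_theta2]
  funext i
  obtain ⟨⟨a, b⟩, rfl⟩ := toLex.surjective i
  fin_cases a
  fin_cases b <;> simp [plusUps, siteRank, kgp1x5_NCCOx_c2_lh_mum86o10_V]
  all_goals norm_num

/-- **Table identity ν, corner 2**: box-p2's potential table `M / 80000` (tilt folded in) IS `plusNu θ_2 2`. [cite: ValentiStolzeHirschfeld1991, §II] -/
theorem nCCOK26Floor_nu2 :
    (fun x : Fin 1 ×ₗ Fin 5 => ((kgp1x5_NCCOx_c2_lh_mum86o10_M (siteRank x) : ℤ) : ℝ) / (80000 : ℕ)) =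
      plusNu (emeryLine cuprateSigns (nCCOK26Corner 2) + (-43/5 : ℝ) • levelDir) 2 := by
  rw [nCCOK26Floor_theta2]
  funext i
  obtain ⟨⟨a, b⟩, rfl⟩ := toLex.surjective i
  fin_cases a
  fin_cases b <;> simp [plusNu, siteRank, kgp1x5_NCCOx_c2_lh_mum86o10_M]
  all_goals norm_num

/-- **The cluster certificate at corner 2**: `H^(w_2)_(W₅)[emeryInteraction θ_2] + 0 − q₀·1 ⪰ 0` with `q₀ = -1467193/20000` — box-p2's kernel sector floors
`kgp1x5_NCCOx_c2_lh_mum86o10_floor_min` through box-p1's dictionary + glue. [cite: Anderson1951, eq. (2)] -/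
theorem nCCOK26Floor_hq2 :
    ((⟨fun X => (uniformPeriodicWeight liebPeriods emeryCuO4Window 2 X : ℂ) •
        (emeryInteraction (emeryLine cuprateSigns (nCCOK26Corner 2) + (-43/5 : ℝ) • levelDir)).Φ X⟩ : FermionInteraction 2).localHamiltonian emeryCuO4Window +
        (0 : FermionOp emeryCuO4Window) - ((-1467193/20000 : ℝ) : ℂ) • (1 : FermionOp emeryCuO4Window)).PosSemidef := by
  refine posSemidef_cuO4_uniform_add_zero_sub_of_gpSectorFloors _ 2 fun k hk => ?_
  have h := kgp1x5_NCCOx_c2_lh_mum86o10_floor_min k hk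
  rw [nCCOK26Floor_tau2, nCCOK26Floor_ups2, nCCOK26Floor_nu2] at h
  exact_mod_cast h

/-- The tilted coupling vector at corner 3 (`nCCOK26Corner 3`, tilt `μ = -19/2`), explicitly. [folklore] -/
theorem nCCOK26Floor_theta3 :
    emeryLine cuprateSigns (nCCOK26Corner 3) + (-19/2 : ℝ) • levelDir =
      ![129/100, 129/100, 129/100, 129/100, -(18/25), -(18/25), -(18/25), -(18/25), 13/25 - 19/2, -(19/2), -(19/2), 5287/1000, 2249/500, 2249/500] := by
  rw [emeryLine_cuprateSigns]
  ext a
  fin_cases a <;> simp [nCCOK26Corner, levelDir]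
  all_goals norm_num

/-- **Table identity τ, corner 3**: box-p2's hopping table `symW W0 / 80000` IS `plusTau θ_3 2`. [cite: ValentiStolzeHirschfeld1991, §II] -/
theorem nCCOK26Floor_tau3 :
    (fun x y : Fin 1 ×ₗ Fin 5 => ((symW kgp1x5_NCCOx_c3_hh_mum95o10_W0 (siteRank x) (siteRank y) : ℤ) : ℝ) / (80000 : ℕ)) =
      plusTau (emeryLine cuprateSigns (nCCOK26Corner 3) + (-19/2 : ℝ) • levelDir) 2 := by
  rw [nCCOK26Floor_theta3]
  funext i j
  obtain ⟨⟨a, b⟩, rfl⟩ := toLex.surjective i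
  obtain ⟨⟨c, d⟩, rfl⟩ := toLex.surjective j
  fin_cases a; fin_cases c
  fin_cases b <;> fin_cases d <;> simp [plusTau, symW, siteRank, kgp1x5_NCCOx_c3_hh_mum95o10_W0]
  all_goals norm_num

/-- **Table identity υ, corner 3**: box-p2's repulsion table `V / 80000` IS `plusUps θ_3 2`. [cite: ValentiStolzeHirschfeld1991, §II] -/
theorem nCCOK26Floor_ups3 :
    (fun x : Fin 1 ×ₗ Fin 5 => ((kgp1x5_NCCOx_c3_hh_mum95o10_V (siteRank x) : ℤ) : ℝ) / (80000 : ℕ)) =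
      plusUps (emeryLine cuprateSigns (nCCOK26Corner 3) + (-19/2 : ℝ) • levelDir) 2 := by
  rw [nCCOK26Floor_theta3]
  funext i
  obtain ⟨⟨a, b⟩, rfl⟩ := toLex.surjective i
  fin_cases a
  fin_cases b <;> simp [plusUps, siteRank, kgp1x5_NCCOx_c3_hh_mum95o10_V]
  all_goals norm_num

/-- **Table identity ν, corner 3**: box-p2's potential table `M / 80000` (tilt folded in) IS `plusNu θ_3 2`. [cite: ValentiStolzeHirschfeld1991, §II] -/
theorem nCCOK26Floor_nu3 :
    (fun x : Fin 1 ×ₗ Fin 5 => ((kgp1x5_NCCOx_c3_hh_mum95o10_M (siteRank x) : ℤ) : ℝ) / (80000 : ℕ)) =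
      plusNu (emeryLine cuprateSigns (nCCOK26Corner 3) + (-19/2 : ℝ) • levelDir) 2 := by
  rw [nCCOK26Floor_theta3]
  funext i
  obtain ⟨⟨a, b⟩, rfl⟩ := toLex.surjective i
  fin_cases a
  fin_cases b <;> simp [plusNu, siteRank, kgp1x5_NCCOx_c3_hh_mum95o10_M]
  all_goals norm_num

/-- **The cluster certificate at corner 3**: `H^(w_2)_(W₅)[emeryInteraction θ_3] + 0 − q₀·1 ⪰ 0` with `q₀ = -3377403/40000` — box-p2's kernel sector floors
`kgp1x5_NCCOx_c3_hh_mum95o10_floor_min` through box-p1's dictionary + glue. [cite: Anderson1951, eq. (2)] -/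
theorem nCCOK26Floor_hq3 :
    ((⟨fun X => (uniformPeriodicWeight liebPeriods emeryCuO4Window 2 X : ℂ) •
        (emeryInteraction (emeryLine cuprateSigns (nCCOK26Corner 3) + (-19/2 : ℝ) • levelDir)).Φ X⟩ : FermionInteraction 2).localHamiltonian emeryCuO4Window +
        (0 : FermionOp emeryCuO4Window) - ((-3377403/40000 : ℝ) : ℂ) • (1 : FermionOp emeryCuO4Window)).PosSemidef := by
  refine posSemidef_cuO4_uniform_add_zero_sub_of_gpSectorFloors _ 2 fun k hk => ?_
  have h := kgp1x5_NCCOx_c3_hh_mum95o10_floor_min k hk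
  rw [nCCOK26Floor_tau3, nCCOK26Floor_ups3, nCCOK26Floor_nu3] at h
  exact_mod_cast h

/-! ## §2 Tilts, levels, and the door's hypotheses -/

/-- The four tilts `μ = (-8, -9, -43/5, -19/2)` eV (box-p2's float scan). [folklore] -/
def nCCOK26Floor_mu : Fin 4 → ℝ := ![-8, -9, -43/5, -19/2]

/-- The four certified cluster levels `q₀ = (-2654597/40000, -6279593/80000, -1467193/20000, -3377403/40000)` (cluster units = eV at mass 2). [folklore] -/
def nCCOK26Floor_q0 : Fin 4 → ℝ := ![-2654597/40000, -6279593/80000, -1467193/20000, -3377403/40000]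

/-- **All four certificates** in the shape of the door's `hq` (corners as `nCCOK26Corner`). [cite: Anderson1951, eq. (2)] -/
theorem nCCOK26Floor_hq : ∀ i : Fin 4,
    ((⟨fun X => (uniformPeriodicWeight liebPeriods emeryCuO4Window 2 X : ℂ) •
        (emeryInteraction (emeryLine cuprateSigns (nCCOK26Corner i) + nCCOK26Floor_mu i • levelDir)).Φ X⟩ : FermionInteraction 2).localHamiltonian emeryCuO4Window +
        (fun _ : Fin 4 => (0 : FermionOp emeryCuO4Window)) i - ((nCCOK26Floor_q0 i : ℝ) : ℂ) • (1 : FermionOp emeryCuO4Window)).PosSemidef := by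
  intro i
  fin_cases i
  · simpa [nCCOK26Floor_mu, nCCOK26Floor_q0] using nCCOK26Floor_hq0
  · simpa [nCCOK26Floor_mu, nCCOK26Floor_q0] using nCCOK26Floor_hq1
  · simpa [nCCOK26Floor_mu, nCCOK26Floor_q0] using nCCOK26Floor_hq2
  · simpa [nCCOK26Floor_mu, nCCOK26Floor_q0] using nCCOK26Floor_hq3

/-- **The same certificates at the door's corner spelling** `lowerCorner (emeryLo 0 …) (emeryHi 0 …) i`. [cite: Anderson1951, eq. (2)] -/
theorem nCCOK26Floor_hq_lowerCorner : ∀ i : Fin 4,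
    ((⟨fun X => (uniformPeriodicWeight liebPeriods emeryCuO4Window 2 X : ℂ) •
        (emeryInteraction (emeryLine cuprateSigns (lowerCorner (emeryLo 0 nccoK26Emery_tpd nccoK26Emery_tpp nccoK26Emery_Delta nccoK26Emery_Udd nccoK26Emery_Upp)
          (emeryHi 0 nccoK26Emery_tpd nccoK26Emery_tpp nccoK26Emery_Delta nccoK26Emery_Udd nccoK26Emery_Upp) i) + nCCOK26Floor_mu i • levelDir)).Φ X⟩ :
          FermionInteraction 2).localHamiltonian emeryCuO4Window +
        (fun _ : Fin 4 => (0 : FermionOp emeryCuO4Window)) i - ((nCCOK26Floor_q0 i : ℝ) : ℂ) • (1 : FermionOp emeryCuO4Window)).PosSemidef := by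
  rw [nCCOK26_lowerCorner]
  exact nCCOK26Floor_hq

/-- **The corner floors at the filling of record ρ = 103/80**: `q₀ᵢ/8 − μᵢ·ρ = 2.00438 / 1.77564 / 1.90254 / 1.67687` all dominate `536597/320000` (corner 3). [folklore] -/
theorem nCCOK26Floor_hm : ∀ i : Fin 4, (536597/320000 : ℝ) ≤ nCCOK26Floor_q0 i / (4 * 2) - nCCOK26Floor_mu i * (103/80 : ℝ) := by
  intro i
  fin_cases i <;> simp [nCCOK26Floor_mu, nCCOK26Floor_q0] <;> norm_num

/-! ## §3 THE WORD -/

/-- **THE CERTIFIED THREE-BAND WORD on `emeryBoxNCCOK26`** (Nd1.85Ce0.15CuO4 (M20) [#55 x0.10 / #56 Nd2CuO4 x0 share the one-body rows] — U-SLICE «(K)): with the cuprate sign pattern, at the cell filling of record ρ = 103/80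
(`n_holes = 17/20`), the variational ground-state energy density of the decorated three-band model is AT LEAST `536597/320000 = 1.6768656` eV per lattice site
(`6.7074625` eV per CuO₂) — everywhere on the box. Hypothesis-free. [cite: Anderson1951, eq. (2)] [cite: Israel1979, Thm. I.3.4] -/
theorem emeryBoxNCCOK26_cuprate_energyFloor :
    HoldsOn (fun p : EmeryCoord → ℝ =>
      (536597/320000 : ℝ) ≤ emeryEnergyDensity (emeryLine cuprateSigns (emeryLineCoords 0 p)) (103/80 : ℝ)) emeryBoxNCCOK26 := by
  have h := holdsOn_emeryEnergyFloor_of_cuO4Certificates_free (E := emeryBoxNCCOK26) (εp := 0) (eA := nccoK26Emery_tpd) (eB := nccoK26Emery_tpp)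
    (eD := nccoK26Emery_Delta) (eUd := nccoK26Emery_Udd) (eUp := nccoK26Emery_Upp) (by simp [emeryBoxNCCOK26, emeryBoxNCCOK26Src, Function.update]) (by simp [emeryBoxNCCOK26, emeryBoxNCCOK26Src, Function.update]) (Function.update_self _ _ _) (by simp [emeryBoxNCCOK26, emeryBoxNCCOK26Src, Function.update]) (by simp [emeryBoxNCCOK26, emeryBoxNCCOK26Src, Function.update]) cuprateSigns (ρ := 103/80) (by norm_num) (by norm_num) (M := 2) two_pos
    (fun _ => 0) (fun _ ω' _ => re_expect_zero_cuO4 ω') nCCOK26Floor_mu nCCOK26Floor_q0 nCCOK26Floor_hq_lowerCorner nCCOK26Floor_hm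
  simpa using h

/-- **Reading at 4 dp**: `e ≥ 1.6768` eV per lattice site. [cite: Anderson1951, eq. (2)] -/
theorem emeryBoxNCCOK26_cuprate_energyFloor_ge_4dp :
    HoldsOn (fun p : EmeryCoord → ℝ =>
      (16768 / 10000 : ℝ) ≤ emeryEnergyDensity (emeryLine cuprateSigns (emeryLineCoords 0 p)) (103/80 : ℝ)) emeryBoxNCCOK26 :=
  fun p hp => le_trans (by norm_num) (emeryBoxNCCOK26_cuprate_energyFloor p hp)

/-! ## §4 The filling line -/

/-- **The filling line of `emeryBoxNCCOK26`**: `19/2·ρ − 3377403/320000` eV per lattice site = corner 3's tilted line `q₀/8 − μ·ρ` (μ = -19/2). [folklore] -/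
def nCCOK26FloorLine (ρ : ℝ) : ℝ := 19/2 * ρ - 3377403/320000

/-- **The line is the lower envelope of the four corner lines for `ρ ∈ [0, 37/25]`.** [folklore] -/
theorem nCCOK26FloorLine_le_corner (i : Fin 4) {ρ : ℝ} (hρb : ρ ≤ (37/25 : ℝ)) :
    nCCOK26FloorLine ρ ≤ nCCOK26Floor_q0 i / (4 * 2) - nCCOK26Floor_mu i * ρ := by
  unfold nCCOK26FloorLine
  fin_cases i <;> simp [nCCOK26Floor_q0, nCCOK26Floor_mu] <;> nlinarith [hρb]

/-- **THE FILLING-LINE WORD on `emeryBoxNCCOK26`**: for every fixed filling `ρ ∈ [0, 37/25]`, `e(emeryLine cuprateSigns (emeryLineCoords 0 p), ρ) ≥ nCCOK26FloorLine ρ` on the whole box.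
[cite: Anderson1951, eq. (2)] [cite: Israel1979, Thm. I.3.4] -/
theorem emeryBoxNCCOK26_cuprate_energyFloorLine {ρ : ℝ} (hρ0 : 0 ≤ ρ) (hρb : ρ ≤ (37/25 : ℝ)) :
    HoldsOn (fun p : EmeryCoord → ℝ =>
      nCCOK26FloorLine ρ ≤ emeryEnergyDensity (emeryLine cuprateSigns (emeryLineCoords 0 p)) ρ) emeryBoxNCCOK26 := by
  have h := holdsOn_emeryEnergyFloor_of_cuO4Certificates_free (E := emeryBoxNCCOK26) (εp := 0) (eA := nccoK26Emery_tpd) (eB := nccoK26Emery_tpp)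
    (eD := nccoK26Emery_Delta) (eUd := nccoK26Emery_Udd) (eUp := nccoK26Emery_Upp) (by simp [emeryBoxNCCOK26, emeryBoxNCCOK26Src, Function.update]) (by simp [emeryBoxNCCOK26, emeryBoxNCCOK26Src, Function.update]) (Function.update_self _ _ _) (by simp [emeryBoxNCCOK26, emeryBoxNCCOK26Src, Function.update]) (by simp [emeryBoxNCCOK26, emeryBoxNCCOK26Src, Function.update]) cuprateSigns hρ0 (hρb.trans (by norm_num)) (M := 2) two_pos
    (fun _ => 0) (fun _ ω' _ => re_expect_zero_cuO4 ω') nCCOK26Floor_mu nCCOK26Floor_q0 nCCOK26Floor_hq_lowerCorner (fun i => nCCOK26FloorLine_le_corner i hρb)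
  simpa using h

end Summit.Ventures.CertifiedManyBodySolver.Downfold

end
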